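import Mathlib
import Literature.Analysis.FluidPDE.TypeIAncientMild
import Literature.Analysis.FluidPDE.SelfSimilar
import Literature.Analysis.FluidPDE.BarkerPrange2020VorticityAlignmentTypeIHolds
import Literature.Analysis.Calculus.RealAnalyticZeroSetProofs
import Literature.Analysis.FluidPDE.BradshawFarhatGrujic2019ComponentSparseness
import Summits.NavierStokesRegularity.NavierStokesRegularity.Theses.SymmetryModuliCount
import Summits.NavierStokesRegularity.NavierStokesRegularity.Theorems.ScenarioCensusScrewBlowdownVanishing
import Summits.NavierStokesRegularity.NavierStokesRegularity.Theorems.ExtremiserTransienceNearExtremalTransiencePerFlowEternalSymmetry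
import HarnessLib
import Summits.NavierStokesRegularity.NavierStokesRegularity.Theorems.ScenarioCensusEpochMeter

/-!
# Census block A2 (amplitude meters), instrument «SILENCE METER» (receding similarity balls) — cells A2si0 / A2siE / A2siP / A2siU (DECIDED), A2siN (OPEN); REV 2 volume readings
# A2siV / A2siW / A2siS (DECIDED), A2siQ (OPEN) — LINE g16-4 «silence-meter» REV 2 port, part 1/4: §A the instrument (`amp` BY NAME from the epoch-meter port, `simBall`, `SilentAlong`,
# `HasFloor`), §B exact unique continuation inside the class, §C one-limit Liouville (BY NAME), §D the master law, §E the universal floor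

Re-homed for the scenario census (typer seat ns-census-typer-1 g9; the cells A2si0 / A2siE / A2siP / A2siU (LINE g16-4, item 68, census v1.98) and A2siV / A2siW / A2siS (REV 2,
item 72, census v1.101) are MEMBERS OF RECORD «DECIDED IN KERNEL IN FILES» of block A2 (critic PASS; ref PRE-CHECK ✓ §18.8; lead label); this port makes them TREE-decided):
VERBATIM PORT of ns-idea-2 LINE g16-4 «silence-meter» REV 2, `pub/ideators/ns-idea-2/lines/silence-meter/line-silence-meter.rev2.lean` sha16 72a7ac62b938520d (1078 l. =
rev 1 89ff24c1f2a7581c + §I–§K, lean check rc 0, 0 sorry), split for the 400-line rule into `ScenarioCensusSilenceMeter` (§A–§E) → `…SilenceMeterRows` (§F–§G) →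
`…SilenceMeterVolume` (§I laws) → `…SilenceMeterVolumeRows` (§I rows, §J, §K + census KEYS).  Lean text VERBATIM in namespace `…Theorems.ScenarioCensus.SilenceMeter` (the
line's `…Lines.SilenceMeter` re-homed); port edits: `local notation "E3"` → `abbrev E3` (typer lint), `set_option linter.unusedVariables false` dropped (the record: a port
must drop it; unused binders `_`-prefixed where the linter asks, proof text only), the `variable {C} {u}` line and `open MeasureTheory` repeated per part, the instrument `amp`
(+ `amp_nonneg`, `amp_le`) and the one-limit Liouville law `eq_zero_of_blowdownLimit_zero`, shared VERBATIM with the epoch-meter port, taken BY NAME (`EpochMeter.…`),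
`@[conjecture]` on the OPEN rows `Row_A2siN` / `Row_A2siQ` and on the restated residuals `Row_A2arP` / `EnvelopeLiouville` (typed only), one-line docstrings added (gate
lint).  Statements untouched.

No census VALUE is moved here (the cells become TREE-decided by name; booking is the lead's); NS regularity is NOT proved; (L′) ⟨10661⟩ is untouched; no
summit statement is proved by this file. Lemmas that restate already-landed tree declarations are taken BY NAME (gate lint `dedup.landed`): `amp` = `EpochMeter.amp`, `amp_nonneg` = `EpochMeter.amp_nonneg`, `amp_le` = `EpochMeter.amp_le`, `eq_zero_of_blowdownLimit_zero` = `EpochMeter.eq_zero_of_blowdownLimit_zero`.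
-/

-- the summit and its single problem share the name `NavierStokesRegularity` (D-0017 nested layout)
set_option linter.dupNamespace false

noncomputable section

open Set Function Filter Metric
open scoped Topology
open Literature.Analysis.FluidPDE
open Summit.NavierStokesRegularity.NavierStokesRegularity.Theorems

namespace Summit.NavierStokesRegularity.NavierStokesRegularity.Theorems.ScenarioCensus.SilenceMeter

open MeasureTheory

/-- `ℝ³` (the line's `local notation "E3"`, spelled as a reducible abbreviation for the tree). -/
abbrev E3 := EuclideanSpace ℝ (Fin 3)

variable {C : ℝ} {u : ℝ → E3 → E3}

/-! ## A. The instrument -/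

-- `amp`: the line restates the tree's `EpochMeter.amp`; taken BY NAME (gate lint dedup.landed).

/-- The RECEDING SIMILARITY BALL: the physical points at time `s` whose similarity position `x/√(−s)` lies in
`B̄(η₀, ρ)`, i.e. `B̄(√(−s)η₀, ρ√(−s))`. -/
def simBall (η₀ : E3) (ρ s : ℝ) : Set E3 :=
  Metric.closedBall (Real.sqrt (-s) • η₀) (ρ * Real.sqrt (-s))

/-- `u` is SILENT on the similarity ball `B̄(η₀, ρ)` along the far-past times `s k → −∞`: the maximal reading over
`√(−s k)·B̄(η₀, ρ)` tends to `0`. -/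
def SilentAlong (u : ℝ → E3 → E3) (η₀ : E3) (ρ : ℝ) (s : ℕ → ℝ) : Prop :=
  (∀ k, s k < 0) ∧ Tendsto s atTop atBot ∧
    ∃ δ : ℕ → ℝ, Tendsto δ atTop (𝓝 0) ∧ ∀ k, ∀ x ∈ simBall η₀ ρ (s k), EpochMeter.amp u (s k) x ≤ δ k

/-- `u` has the ACTIVITY FLOOR `f` on the similarity ball `B̄(η₀, ρ)`: at EVERY time before some `T < 0` some
reading on `√(−s)·B̄(η₀, ρ)` exceeds `f`. -/
def HasFloor (u : ℝ → E3 → E3) (η₀ : E3) (ρ f : ℝ) : Prop :=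
  ∃ T < (0 : ℝ), ∀ s < T, ∃ x ∈ simBall η₀ ρ s, f < EpochMeter.amp u s x

-- `amp_nonneg`: the line restates the tree's `EpochMeter.amp_nonneg`; taken BY NAME (gate lint dedup.landed).

-- `amp_le`: the line restates the tree's `EpochMeter.amp_le`; taken BY NAME (gate lint dedup.landed).

/-- At time `−1` the reading is the plain norm. -/
theorem amp_neg_one (u : ℝ → E3 → E3) (x : E3) : EpochMeter.amp u (-1) x = ‖u (-1) x‖ := by simp [EpochMeter.amp]

/-- At time `−1` the receding similarity ball is the similarity ball itself. -/
theorem simBall_neg_one (η₀ : E3) (ρ : ℝ) : simBall η₀ ρ (-1) = Metric.closedBall η₀ ρ := by simp [simBall]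

/-- THE METER READS ZOOMS: the amplitude of the `μ`-zoom at `(t, x)` is the amplitude of `u` at `(μ² t, μ x)`. -/
theorem amp_nsRescale {μ t : ℝ} (hμ : 0 < μ) (x : E3) :
    EpochMeter.amp (nsRescale μ u) t x = EpochMeter.amp u (μ ^ 2 * t) (μ • x) := by
  have hsq : Real.sqrt (-(μ ^ 2 * t)) = μ * Real.sqrt (-t) := by
    rw [show -(μ ^ 2 * t) = μ ^ 2 * (-t) by ring, Real.sqrt_mul (sq_nonneg _), Real.sqrt_sq hμ.le]
  simp only [EpochMeter.amp, nsRescale, hsq, norm_smul, Real.norm_eq_abs, abs_of_pos hμ]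
  ring

/-- Zooms map receding similarity balls to receding similarity balls. -/
theorem smul_mem_simBall {μ t : ℝ} (hμ : 0 < μ) (_ht : t < 0) {η₀ x : E3} {ρ : ℝ}
    (hx : x ∈ simBall η₀ ρ t) : μ • x ∈ simBall η₀ ρ (μ ^ 2 * t) := by
  have hsq : Real.sqrt (-(μ ^ 2 * t)) = μ * Real.sqrt (-t) := by
    rw [show -(μ ^ 2 * t) = μ ^ 2 * (-t) by ring, Real.sqrt_mul (sq_nonneg _), Real.sqrt_sq hμ.le]
  rw [simBall, Metric.mem_closedBall, dist_eq_norm] at hx ⊢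
  rw [hsq, show μ • x - (μ * Real.sqrt (-t)) • η₀ = μ • (x - Real.sqrt (-t) • η₀) by
    rw [smul_sub, smul_smul], norm_smul, Real.norm_eq_abs, abs_of_pos hμ, show ρ * (μ * Real.sqrt (-t)) =
    μ * (ρ * Real.sqrt (-t)) by ring]
  exact mul_le_mul_of_nonneg_left hx hμ.le

/-! ## B. Exact unique continuation inside the class (the lever, from tree analyticity) -/

/-- **A slice vanishing on a ball vanishes** (PROVED): slices of class elements are real-analytic on `ℝ³`
(`IsTypeIAncientMild.analyticOnNhd_slice_univ`, Lemarié-Rieusset 2016 Thm. 9.12 as typed in the tree), and `ℝ³`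
is preconnected. -/
theorem slice_eq_zero_of_ball {W : ℝ → E3 → E3} (hW : IsTypeIAncientMild C W) {t₀ : ℝ} (ht₀ : t₀ < 0)
    {c : E3} {ρ : ℝ} (hρ : 0 < ρ) (h0 : ∀ x ∈ Metric.closedBall c ρ, W t₀ x = 0) : ∀ x, W t₀ x = 0 := by
  have han : AnalyticOnNhd ℝ (W t₀) Set.univ := hW.analyticOnNhd_slice_univ ht₀
  have hev : W t₀ =ᶠ[𝓝 c] 0 := by
    filter_upwards [Metric.closedBall_mem_nhds c hρ] with x hx using h0 x hx
  intro x
  exact han.eqOn_zero_of_preconnected_of_eventuallyEq_zero isPreconnected_univ (Set.mem_univ c) hev (Set.mem_univ x)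

/-- **One vanishing slice ⇒ the element vanishes** (PROVED): a zero slice is invariant under every translation,
translation symmetry of one slice is eternal (`translate_of_translate_slice`: forward uniqueness + time analyticity),
so every slice is spatially constant, and the gauge kills spatially constant elements
(`IsTypeIAncientMild.eq_zero_of_slice_const`). -/
theorem eq_zero_of_slice_zero {W : ℝ → E3 → E3} (hW : IsTypeIAncientMild C W) {t₀ : ℝ} (ht₀ : t₀ < 0)
    (h0 : ∀ x, W t₀ x = 0) : ∀ t < 0, ∀ x, W t x = 0 := by
  have htr : ∀ b : E3, ∀ t : ℝ, t < 0 → ∀ x, W t (x + b) = W t x := fun b =>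
    NearExtremalTransiencePerFlow.FilamentSelection.translate_of_translate_slice hW b ht₀
      (fun x => by rw [h0, h0])
  have hconst : ∀ t < 0, ∀ x, W t x = W t 0 := fun t ht x => by
    have h := htr x t ht 0
    rwa [zero_add] at h
  intro t ht x
  exact hW.eq_zero_of_slice_const (b := fun t => W t 0) hconst ht x

/-- Combination: a class element one of whose slices vanishes on a ball is identically zero. -/
theorem eq_zero_of_ball_zero {W : ℝ → E3 → E3} (hW : IsTypeIAncientMild C W) {t₀ : ℝ} (ht₀ : t₀ < 0)
    {c : E3} {ρ : ℝ} (hρ : 0 < ρ) (h0 : ∀ x ∈ Metric.closedBall c ρ, W t₀ x = 0) :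
    ∀ t < 0, ∀ x, W t x = 0 :=
  eq_zero_of_slice_zero hW ht₀ (slice_eq_zero_of_ball hW ht₀ hρ h0)

/-! ## C. One-limit Liouville -/

-- `eq_zero_of_blowdownLimit_zero`: the line restates the tree's `EpochMeter.eq_zero_of_blowdownLimit_zero`; taken BY NAME (gate lint dedup.landed).

/-! ## D. The master law: silence on one receding similarity ball is excluded -/

/-- Blow-down along `μ_k = √(−s_k)`: the limit's slice at time `−1` VANISHES on the similarity ball `B̄(η₀, ρ)`
(readings of the zooms at `(−1, y)` are readings of `u` at `(s_k, μ_k y) ∈ √(−s_k)·B̄(η₀, ρ)`, which tend to `0`). -/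
theorem exists_blowdownLimit_of_silentAlong (hu : IsTypeIAncientMild C u) {η₀ : E3} {ρ : ℝ} {s : ℕ → ℝ}
    (hs : SilentAlong u η₀ ρ s) :
    ∃ W, ScenarioCensus.ScrewBlowdown.IsBlowdownLimit C u W ∧ ∀ y ∈ Metric.closedBall η₀ ρ, W (-1) y = 0 := by
  obtain ⟨hs0, hslim, δ, hδ, hq⟩ := hs
  set μ : ℕ → ℝ := fun k => Real.sqrt (-s k) with hμdef
  have hμpos : ∀ k, 0 < μ k := fun k => Real.sqrt_pos.2 (by linarith [hs0 k])
  have hμsq : ∀ k, μ k ^ 2 = -s k := fun k => Real.sq_sqrt (by linarith [hs0 k])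
  have hμlim : Tendsto μ atTop atTop := by
    have h1 : Tendsto (fun k => -s k) atTop atTop := tendsto_neg_atBot_atTop.comp hslim
    refine tendsto_atTop_atTop.2 fun B => ?_
    obtain ⟨N, hN⟩ := tendsto_atTop_atTop.1 h1 (B ^ 2)
    refine ⟨N, fun k hk => (le_abs_self B).trans ?_⟩
    rw [← Real.sqrt_sq_eq_abs]
    exact Real.sqrt_le_sqrt (hN k hk)
  obtain ⟨φ, hφ, W, hW, -, -, hloc, -⟩ :=
    exists_tendsto_of_isTypeIAncientMild_seq C (w := fun k => nsRescale (μ k) u)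
      fun k => isTypeIAncientMild_nsRescale hu (hμpos k)
  have hBD : ScenarioCensus.ScrewBlowdown.IsBlowdownLimit C u W :=
    ⟨hW, fun j => μ (φ j), fun j => hμpos _, hμlim.comp hφ.tendsto_atTop, fun t ht => hloc t ht⟩
  refine ⟨W, hBD, fun y hy => ?_⟩
  have hL : Tendsto (fun j => nsRescale (μ (φ j)) u (-1) y) atTop (𝓝 (W (-1) y)) :=
    (hloc (-1) (by norm_num)).tendsto_comp (hW.continuous_slice (by norm_num)).continuousAt tendsto_const_nhds
  have hread : ∀ k, ‖nsRescale (μ k) u (-1) y‖ ≤ δ k := by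
    intro k
    have hmem : μ k • y ∈ simBall η₀ ρ (μ k ^ 2 * (-1)) := by
      have hy' : y ∈ simBall η₀ ρ (-1) := by rwa [simBall_neg_one]
      exact smul_mem_simBall (hμpos k) (by norm_num) hy'
    have ht : μ k ^ 2 * (-1 : ℝ) = s k := by rw [hμsq]; ring
    rw [← amp_neg_one, amp_nsRescale (hμpos k), ht]
    rw [ht] at hmem
    exact hq k _ hmem
  have hle : ‖W (-1) y‖ ≤ 0 :=
    le_of_tendsto_of_tendsto' hL.norm (hδ.comp hφ.tendsto_atTop) fun j => hread (φ j)
  exact norm_le_zero_iff.1 hle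

/-- **MASTER LAW** (PROVED): a Type-I ancient mild field that is SILENT on ONE receding similarity ball
`√(−s_k)·B̄(η₀, ρ)` (`ρ > 0`, any centre) along ONE sequence of far-past times `s_k → −∞` is identically zero. -/
theorem eq_zero_of_silentAlong (hu : IsTypeIAncientMild C u) {η₀ : E3} {ρ : ℝ} {s : ℕ → ℝ} (hρ : 0 < ρ)
    (hs : SilentAlong u η₀ ρ s) : ∀ t < 0, ∀ x, u t x = 0 := by
  obtain ⟨W, hW, h0⟩ := exists_blowdownLimit_of_silentAlong hu hs
  exact EpochMeter.eq_zero_of_blowdownLimit_zero hu hW (eq_zero_of_ball_zero hW.1 (by norm_num) hρ h0)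

/-- The «before every time there is a quieter time» form yields a silent sequence. -/
theorem silentAlong_of_forall {η₀ : E3} {ρ : ℝ}
    (h : ∀ f > (0 : ℝ), ∀ T < (0 : ℝ), ∃ s < T, ∀ x ∈ simBall η₀ ρ s, EpochMeter.amp u s x ≤ f) :
    ∃ s : ℕ → ℝ, SilentAlong u η₀ ρ s := by
  have h' : ∀ k : ℕ, ∃ s < -((k : ℝ) + 1), ∀ x ∈ simBall η₀ ρ s, EpochMeter.amp u s x ≤ 1 / ((k : ℝ) + 1) :=
    fun k => h _ (by positivity) _ (by linarith [(Nat.cast_nonneg k : (0 : ℝ) ≤ k)])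
  choose s hs hq using h'
  refine ⟨s, fun k => by linarith [hs k, (Nat.cast_nonneg k : (0 : ℝ) ≤ k)], ?_, fun k => 1 / ((k : ℝ) + 1),
    tendsto_one_div_add_atTop_nhds_zero_nat, hq⟩
  have hlin : Tendsto (fun k : ℕ => -((k : ℝ) + 1)) atTop atBot :=
    tendsto_neg_atTop_atBot.comp (tendsto_atTop_add_const_right atTop (1 : ℝ) tendsto_natCast_atTop_atTop)
  exact tendsto_atBot_mono (fun k => (hs k).le) hlin

/-- **FLOOR LAW, element form** (PROVED): a NONZERO element has a positive activity floor on every similarity ball —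
at every sufficiently early time some reading on `√(−s)·B̄(η₀, ρ)` exceeds `f = f(u, B) > 0`. -/
theorem hasFloor_of_ne_zero' (hu : IsTypeIAncientMild C u) (hne : ∃ t < 0, ∃ x, u t x ≠ 0) (η₀ : E3) {ρ : ℝ}
    (hρ : 0 < ρ) : ∃ f > 0, HasFloor u η₀ ρ f := by
  by_contra H
  push Not at H
  have h : ∀ f > (0 : ℝ), ∀ T < (0 : ℝ), ∃ s < T, ∀ x ∈ simBall η₀ ρ s, EpochMeter.amp u s x ≤ f := by
    intro f hf T hT
    have h1 : ¬ HasFloor u η₀ ρ f := H f hf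
    simp only [HasFloor, not_exists, not_and, not_forall, not_lt] at h1
    obtain ⟨s, hs, hs'⟩ := h1 T hT
    exact ⟨s, hs, hs'⟩
  obtain ⟨s, hsil⟩ := silentAlong_of_forall h
  obtain ⟨t, ht, x, hx⟩ := hne
  exact hx (eq_zero_of_silentAlong hu hρ hsil t ht x)

/-! ## E. The universal floor (compactness upgrade; the N1 datum) -/

/-- **UNIVERSAL FLOOR ON EVERY SIMILARITY BALL** (PROVED): for every `C` and every similarity ball `B̄(η₀, ρ)`
(`ρ > 0`) there is `f = f(C, η₀, ρ) > 0` such that NO nonzero `u ∈ A_C` is `f`-quiet on `√(−s_k)·B̄(η₀, ρ)` along a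
sequence `s_k → −∞`.  (Zoom each offender to time `−1` at a scale beyond its substantiality threshold
`substantial_at_large_scales`; a class limit of the zooms is `ε_C`-loud at some `(−1, y_∞)`, `‖y_∞‖ ≤ K_C`, yet its
slice at `−1` vanishes on `B̄(η₀, ρ)` — impossible by exact unique continuation.)  The case `B = B̄(0, K_C)`,
`f = ε_C` is the tree's `substantial_at_large_scales` itself. -/
theorem universal_floor (C : ℝ) (η₀ : E3) {ρ : ℝ} (hρ : 0 < ρ) :
    ∃ f > (0 : ℝ), ∀ u : ℝ → E3 → E3, IsTypeIAncientMild C u → (∃ t < (0 : ℝ), ∃ x, u t x ≠ 0) →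
      ∀ s : ℕ → ℝ, (∀ k, s k < 0) → Tendsto s atTop atBot →
        ∃ k, ∃ x ∈ simBall η₀ ρ (s k), f < EpochMeter.amp u (s k) x := by
  by_contra H
  push Not at H
  obtain ⟨ε, hε, K, hK, hsub⟩ := ScenarioCensus.ScrewBlowdown.substantial_at_large_scales C
  -- Step 1: for every `n` a class element, `ε`-loud at some `(−1, y)` with `‖y‖ ≤ K`, and `1/(n+1)`-quiet on
  -- `B̄(η₀, ρ)` at time `−1` (an offender zoomed to a far-past quiet time beyond its substantiality threshold).
  have hn : ∀ n : ℕ, ∃ v : ℝ → E3 → E3, IsTypeIAncientMild C v ∧ (∃ y : E3, ‖y‖ ≤ K ∧ ε < ‖v (-1) y‖) ∧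
      ∀ x ∈ Metric.closedBall η₀ ρ, ‖v (-1) x‖ ≤ 1 / ((n : ℝ) + 1) := by
    intro n
    obtain ⟨u, hu, hne, s, hs0, hslim, hq⟩ := H (1 / ((n : ℝ) + 1)) (by positivity)
    obtain ⟨μ₁, hμ₁, hloud⟩ := hsub u hu hne
    have hev : ∀ᶠ k in atTop, μ₁ ^ 2 ≤ -s k := (tendsto_neg_atBot_atTop.comp hslim).eventually_ge_atTop _
    obtain ⟨k, hk⟩ := hev.exists
    have hsk : 0 < -s k := by linarith [hs0 k]
    set μ : ℝ := Real.sqrt (-s k) with hμdef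
    have hμpos : 0 < μ := Real.sqrt_pos.2 hsk
    have hμsq : μ ^ 2 = -s k := Real.sq_sqrt hsk.le
    have hμ₁le : μ₁ ≤ μ := by
      calc μ₁ = Real.sqrt (μ₁ ^ 2) := (Real.sqrt_sq hμ₁.le).symm
        _ ≤ Real.sqrt (-s k) := Real.sqrt_le_sqrt hk
    refine ⟨nsRescale μ u, isTypeIAncientMild_nsRescale hu hμpos, hloud μ hμ₁le, fun x hx => ?_⟩
    have hmem : μ • x ∈ simBall η₀ ρ (μ ^ 2 * (-1)) := by
      have hx' : x ∈ simBall η₀ ρ (-1) := by rwa [simBall_neg_one]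
      exact smul_mem_simBall hμpos (by norm_num) hx'
    have ht : μ ^ 2 * (-1 : ℝ) = s k := by rw [hμsq]; ring
    rw [← amp_neg_one, amp_nsRescale hμpos, ht]
    rw [ht] at hmem
    exact hq k _ hmem
  choose v hv hyv hqv using hn
  choose y hyK hyε using hyv
  -- Step 2: a convergent subsequence of the loud points, then a class limit of the fields along it.
  obtain ⟨yL, -, ψ, hψ, hylim⟩ := (isCompact_closedBall (0 : E3) K).tendsto_subseq
    (fun n => show y n ∈ Metric.closedBall (0 : E3) K by
      rw [Metric.mem_closedBall, dist_zero_right]; exact hyK n)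
  obtain ⟨φ, hφ, V, hV, -, -, hloc, -⟩ :=
    exists_tendsto_of_isTypeIAncientMild_seq C (w := fun j => v (ψ j)) fun j => hv (ψ j)
  -- Step 3: the limit is `ε`-loud at `(−1, yL)` …
  have hL1 : Tendsto (fun j => v (ψ (φ j)) (-1) (y (ψ (φ j)))) atTop (𝓝 (V (-1) yL)) :=
    (hloc (-1) (by norm_num)).tendsto_comp (hV.continuous_slice (by norm_num)).continuousAt
      (hylim.comp hφ.tendsto_atTop)
  have hVy : ε ≤ ‖V (-1) yL‖ := ge_of_tendsto' hL1.norm fun j => (hyε (ψ (φ j))).le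
  -- … and its slice at `−1` vanishes on `B̄(η₀, ρ)`, hence the limit is zero: contradiction.
  have hV0 : ∀ x ∈ Metric.closedBall η₀ ρ, V (-1) x = 0 := by
    intro x hx
    have hL2 : Tendsto (fun j => v (ψ (φ j)) (-1) x) atTop (𝓝 (V (-1) x)) :=
      (hloc (-1) (by norm_num)).tendsto_comp (hV.continuous_slice (by norm_num)).continuousAt tendsto_const_nhds
    have hδ : Tendsto (fun j => 1 / ((ψ (φ j) : ℝ) + 1)) atTop (𝓝 0) :=
      tendsto_one_div_add_atTop_nhds_zero_nat.comp ((hψ.comp hφ).tendsto_atTop)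
    have hle : ‖V (-1) x‖ ≤ 0 :=
      le_of_tendsto_of_tendsto' hL2.norm hδ fun j => hqv (ψ (φ j)) x hx
    exact norm_le_zero_iff.1 hle
  have hVall := eq_zero_of_ball_zero hV (by norm_num) hρ hV0
  rw [hVall (-1) (by norm_num) yL, norm_zero] at hVy
  exact absurd hVy (not_le.2 hε)

/-- **UNIVERSAL FLOOR, every-time form** (PROVED): with the universal level `f(C, η₀, ρ)` of `universal_floor`,
every NONZERO `u ∈ A_C` has the floor `f` on `B̄(η₀, ρ)` at EVERY time before some `T(u) < 0`. -/
theorem hasFloor_of_ne_zero (C : ℝ) (η₀ : E3) {ρ : ℝ} (hρ : 0 < ρ) :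
    ∃ f > (0 : ℝ), ∀ u : ℝ → E3 → E3, IsTypeIAncientMild C u → (∃ t < (0 : ℝ), ∃ x, u t x ≠ 0) →
      HasFloor u η₀ ρ f := by
  obtain ⟨f, hf, hfl⟩ := universal_floor C η₀ hρ
  refine ⟨f, hf, fun u hu hne => ?_⟩
  by_contra H
  simp only [HasFloor, not_exists, not_and, not_forall, not_lt] at H
  -- before every time there is a time at which all readings on the ball are `≤ f`
  have h' : ∀ k : ℕ, ∃ s < -((k : ℝ) + 1), ∀ x ∈ simBall η₀ ρ s, EpochMeter.amp u s x ≤ f := by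
    intro k
    obtain ⟨s, hs, hs'⟩ := H (-((k : ℝ) + 1)) (by linarith [(Nat.cast_nonneg k : (0 : ℝ) ≤ k)])
    exact ⟨s, hs, hs'⟩
  choose s hs hq using h'
  have hs0 : ∀ k, s k < 0 := fun k => by linarith [hs k, (Nat.cast_nonneg k : (0 : ℝ) ≤ k)]
  have hlin : Tendsto (fun k : ℕ => -((k : ℝ) + 1)) atTop atBot :=
    tendsto_neg_atTop_atBot.comp (tendsto_atTop_add_const_right atTop (1 : ℝ) tendsto_natCast_atTop_atTop)
  have hslim : Tendsto s atTop atBot := tendsto_atBot_mono (fun k => (hs k).le) hlin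
  obtain ⟨k, x, hx, hlt⟩ := hfl u hu hne s hs0 hslim
  exact absurd (hq k x hx) (not_le.2 hlt)

end Summit.NavierStokesRegularity.NavierStokesRegularity.Theorems.ScenarioCensus.SilenceMeter

end
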